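import Summits.Ventures.PercRepro.RankLevelSetRuleQCellOne
import Summits.Ventures.PercRepro.RankLevelSetRuleQCellFourRow

/-!
# PercRepro — (R̂) ON THE SLICE `#P = 2` OF EVERY CELL `(q+k, q)` WITH `q ≥ k + 1`, FOR EVERY `k ≥ 2`
(p4, gen 22; C-044; paper proofs/P4-CELL-THREE.md §9)

`rhat_two_ge (q k) (2 ≤ k) (k + 1 ≤ q) : phiK (q + k) q ≤ rhat q k 2` and the matroid form
`ruleQRecv_ge_of_flatPart_eq_two`: Rule Q pays `Φ(q+k, q)` to every member with flat part of size `2` of every cell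
`(q+k, q)` with `q ≥ k + 1` at the tight layer of every finite matroid, for EVERY `k ≥ 2`.  With night-1's `rhat_zero_eq`
(`#P = 0`, equality) and `rhatCell_one` (`#P = 1`) this covers the three smallest flat parts of every cell family; it is the
slice on which the UNTRUNCATED regime `u = q − m ≥ k − 1` of (R̂) is tightest (relative margin `≈ 1.5/k²` at `q = k + 1`,
`≈ c/q` for large `q`), while the truncated slices `u ≤ k − 3` are where (R̂) fails for `k ≥ 5` (RankLevelSetRuleQCellFiveWitness).

THE PROOF. For `q ≥ k + 1` every `m̂(q, 2; a, j)`, `j ≤ k − 1 ≤ q − 2`, is untruncated, `= C(q+j+a, a+j)` (`mhat_two_eq`: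
`mhat_eq` + Vandermonde), so with `A(j) = 1/C(q+j, j)` and `k = K + 2`:
`R̂(q, k, 2) = Σ_{i ≤ K} C(q+K, i+1)·(A(i+1) + 2A(i+2) + A(i+3))` (`rhat_two_eq`) and
`Φ(q+k, q) = Σ_{i ≤ K} C(q+K+2, i+1)·A(i+1)` (`phiK_two_eq`).  Pascal twice, `C(n+2, j) = C(n, j) + 2C(n, j−1) + C(n, j−2)`,
makes the difference TELESCOPE (`sliceTwo_telescope`, any `n`, any `A`, by induction on `K`):
`R̂ − Φ = 2C(q+K, K+1)·A(K+2) + C(q+K, K)·A(K+2) + C(q+K, K+1)·A(K+3) − 2A(1) − A(2)`.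
The four binomial ratios are rational functions of `(q, K)` (`ratio_one/two/three`, `choose_two_one`):
`R̂ − Φ = [2q(K+2) + (K+1)(K+2)]/((q+K+1)(q+K+2)) + q(K+2)(K+3)/((q+K+1)(q+K+2)(q+K+3)) − 2(q+3)/((q+1)(q+2))`,
and with `q = K + 3 + y` the numerator is a polynomial in `(K, y)` with 20 POSITIVE coefficients (`sliceTwo_core`:
`600 + 670y + … + 7K⁵`), so `R̂ − Φ > 0` on the whole slice (`rhat_two_ge'`).  Twin (exact rationals, work/m2/m2check.py):
the closed form agrees with the tree's `rhat`/`phiK` on all `(q, k)`, `k ≤ 15`, `k + 1 ≤ q ≤ k + 40`; relative margins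
`0.200, 0.139, 0.077, 0.036, 0.015, 0.008` at `q = k + 1`, `k = 2, 3, 5, 8, 12, 15`.  Axioms: standard.
-/

namespace PercRepro

open Finset

/-- `m̂(q, 2; a, j) = C(q+j+a, a+j)` whenever `j ≤ q − 2` (the truncation is void). -/
lemma mhat_two_eq (q a j : ℕ) (hj : j ≤ q - 2) : mhat q 2 a j = (q + j + a).choose (a + j) := by
  rw [mhat_eq, show min j (q - 2) = j by omega, sum_choose_mul_choose_add (q + a) a j,
    show q + a + j = q + j + a by ring]

/-- Pascal twice: `C(n+2, K+2) = C(n, K+2) + 2·C(n, K+1) + C(n, K)`. -/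
lemma choose_add_two_succ_succ (n K : ℕ) :
    (n + 2).choose (K + 2) = n.choose (K + 2) + 2 * n.choose (K + 1) + n.choose K := by
  rw [show n + 2 = (n + 1) + 1 by ring, Nat.choose_succ_succ, Nat.choose_succ_succ, Nat.choose_succ_succ]
  ring

/-- **The telescoping identity** behind the slice `#P = 2`: for any `n`, any `A : ℕ → ℚ` and any `K`,
`Σ_{i ≤ K} C(n, i+1)·(A(i+1) + 2A(i+2) + A(i+3)) − Σ_{i ≤ K} C(n+2, i+1)·A(i+1)
  = 2C(n, K+1)·A(K+2) + C(n, K)·A(K+2) + C(n, K+1)·A(K+3) − 2A(1) − A(2)`. -/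
lemma sliceTwo_telescope (n : ℕ) (A : ℕ → ℚ) (K : ℕ) :
    ∑ i ∈ range (K + 1), (n.choose (i + 1) : ℚ) * (A (i + 1) + 2 * A (i + 2) + A (i + 3))
      - ∑ i ∈ range (K + 1), ((n + 2).choose (i + 1) : ℚ) * A (i + 1)
    = 2 * (n.choose (K + 1) : ℚ) * A (K + 2) + (n.choose K : ℚ) * A (K + 2)
      + (n.choose (K + 1) : ℚ) * A (K + 3) - 2 * A 1 - A 2 := by
  induction K with
  | zero =>
    simp only [Finset.sum_range_one, Nat.choose_one_right, Nat.choose_zero_right, zero_add]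
    push_cast
    ring
  | succ K ih =>
    rw [Finset.sum_range_succ _ (K + 1), Finset.sum_range_succ _ (K + 1)]
    have hp : ((n + 2).choose (K + 2) : ℚ) = n.choose (K + 2) + 2 * n.choose (K + 1) + n.choose K := by
      rw [choose_add_two_succ_succ]
      push_cast
      ring
    rw [show K + 1 + 1 = K + 2 by rfl, show K + 1 + 2 = K + 3 by rfl, show K + 1 + 3 = K + 4 by rfl]
    linear_combination ih - A (K + 2) * hp


/-- `R̂(q, K+2, 2)` in the shape of the telescoping identity (`q ≥ K + 3`: every `j ≤ K + 1` is untruncated):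
`R̂ = Σ_{i ≤ K} C(q+K, i+1)·(A(i+1) + 2A(i+2) + A(i+3))`, `A j = 1/C(q+j, j)`. -/
lemma rhat_two_eq (q K : ℕ) (hq : K + 3 ≤ q) :
    rhat q (K + 2) 2 = ∑ i ∈ range (K + 1), ((q + K).choose (i + 1) : ℚ)
      * (1 / ((q + (i + 1)).choose (i + 1) : ℚ) + 2 * (1 / ((q + (i + 2)).choose (i + 2) : ℚ))
        + 1 / ((q + (i + 3)).choose (i + 3) : ℚ)) := by
  unfold rhat
  rw [sum_Ioo_nat, show K + 2 - (0 + 1) = K + 1 by omega]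
  refine Finset.sum_congr rfl (fun i hi => ?_)
  rw [Finset.mem_range] at hi
  have h1 : mhat q 2 0 (i + 1) = (q + (i + 1)).choose (i + 1) := by
    rw [mhat_two_eq q 0 (i + 1) (by omega), show q + (i + 1) + 0 = q + (i + 1) by ring,
      show 0 + (i + 1) = i + 1 by ring]
  have h2 : mhat q 2 1 (i + 1) = (q + (i + 2)).choose (i + 2) := by
    rw [mhat_two_eq q 1 (i + 1) (by omega), show q + (i + 1) + 1 = q + (i + 2) by ring,
      show 1 + (i + 1) = i + 2 by ring]
  have h3 : mhat q 2 2 (i + 1) = (q + (i + 3)).choose (i + 3) := by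
    rw [mhat_two_eq q 2 (i + 1) (by omega), show q + (i + 1) + 2 = q + (i + 3) by ring,
      show 2 + (i + 1) = i + 3 by ring]
  simp only [show 0 + 1 + i = i + 1 by ring, show q + (K + 2) - 2 = q + K by omega]
  simp only [Finset.sum_range_succ, Finset.sum_range_zero, h1, h2, h3, Nat.choose_zero_right,
    Nat.choose_one_right, Nat.choose_self]
  push_cast
  ring

/-- `Φ(q+K+2, q)` in the same shape: `Σ_{i ≤ K} C(q+K+2, i+1)·A(i+1)`. -/
lemma phiK_two_eq (q K : ℕ) :
    phiK (q + (K + 2)) q = ∑ i ∈ range (K + 1), ((q + K + 2).choose (i + 1) : ℚ)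
      * (1 / ((q + (i + 1)).choose (i + 1) : ℚ)) := by
  rw [phiK_eq_sum_range q (K + 2) (by omega), show K + 2 - 1 = K + 1 by omega]
  refine Finset.sum_congr rfl (fun i _ => ?_)
  rw [show q + i + 1 = q + (i + 1) by ring, Nat.choose_symm_add, show q + (K + 2) = q + K + 2 by ring,
    div_eq_mul_one_div]


/-! ### The four binomial ratios of the slice, as rational functions of `(q, K)` -/

/-- `C(q+K, K+1)/C(q+K+2, K+2) = (K+2)q/((q+K+1)(q+K+2))`. -/
lemma ratio_one (q K : ℕ) :
    ((q + K).choose (K + 1) : ℚ) / ((q + K + 2).choose (K + 2) : ℚ)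
      = (K + 2) * q / ((q + K + 1) * (q + K + 2)) := by
  have c0 : ((q + K).choose (K + 1) : ℚ) * (K + 1) = ((q + K).choose K : ℚ) * q := by
    have h := Nat.choose_succ_right_eq (q + K) K
    rw [Nat.add_sub_cancel] at h
    exact_mod_cast h
  have c1 : ((q + K + 1).choose (K + 1) : ℚ) * (K + 1) = ((q + K).choose K : ℚ) * (q + K + 1) := by
    have h := Nat.add_one_mul_choose_eq (q + K) K
    have h' := congrArg (Nat.cast (R := ℚ)) h
    push_cast at h'
    linarith
  have c2 : ((q + K + 2).choose (K + 2) : ℚ) * (K + 2) = ((q + K + 1).choose (K + 1) : ℚ) * (q + K + 2) := by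
    have h := Nat.add_one_mul_choose_eq (q + K + 1) (K + 1)
    rw [show q + K + 1 + 1 = q + K + 2 by ring, show K + 1 + 1 = K + 2 by rfl] at h
    have h' := congrArg (Nat.cast (R := ℚ)) h
    push_cast at h'
    linarith
  have hpos : (0 : ℚ) < ((q + K + 2).choose (K + 2) : ℚ) := by exact_mod_cast Nat.choose_pos (by omega)
  rw [div_eq_div_iff hpos.ne' (by positivity)]
  apply mul_left_cancel₀ (show ((K : ℚ) + 1) ≠ 0 by positivity)
  linear_combination ((q + K + 1) * (q + K + 2)) * c0 - (q * (q + K + 2)) * c1 - (q * (K + 1)) * c2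

/-- `C(q+K, K)/C(q+K+2, K+2) = (K+1)(K+2)/((q+K+1)(q+K+2))`. -/
lemma ratio_two (q K : ℕ) :
    ((q + K).choose K : ℚ) / ((q + K + 2).choose (K + 2) : ℚ)
      = (K + 1) * (K + 2) / ((q + K + 1) * (q + K + 2)) := by
  have c1 : ((q + K + 1).choose (K + 1) : ℚ) * (K + 1) = ((q + K).choose K : ℚ) * (q + K + 1) := by
    have h := Nat.add_one_mul_choose_eq (q + K) K
    have h' := congrArg (Nat.cast (R := ℚ)) h
    push_cast at h'
    linarith
  have c2 : ((q + K + 2).choose (K + 2) : ℚ) * (K + 2) = ((q + K + 1).choose (K + 1) : ℚ) * (q + K + 2) := by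
    have h := Nat.add_one_mul_choose_eq (q + K + 1) (K + 1)
    rw [show q + K + 1 + 1 = q + K + 2 by ring, show K + 1 + 1 = K + 2 by rfl] at h
    have h' := congrArg (Nat.cast (R := ℚ)) h
    push_cast at h'
    linarith
  have hpos : (0 : ℚ) < ((q + K + 2).choose (K + 2) : ℚ) := by exact_mod_cast Nat.choose_pos (by omega)
  rw [div_eq_div_iff hpos.ne' (by positivity)]
  linear_combination (-(q + K + 2)) * c1 - (K + 1) * c2

/-- `C(q+K, K+1)/C(q+K+3, K+3) = (K+2)(K+3)q/((q+K+1)(q+K+2)(q+K+3))`. -/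
lemma ratio_three (q K : ℕ) :
    ((q + K).choose (K + 1) : ℚ) / ((q + K + 3).choose (K + 3) : ℚ)
      = (K + 2) * (K + 3) * q / ((q + K + 1) * (q + K + 2) * (q + K + 3)) := by
  have c3 : ((q + K + 3).choose (K + 3) : ℚ) * (K + 3) = ((q + K + 2).choose (K + 2) : ℚ) * (q + K + 3) := by
    have h := Nat.add_one_mul_choose_eq (q + K + 2) (K + 2)
    rw [show q + K + 2 + 1 = q + K + 3 by ring, show K + 2 + 1 = K + 3 by rfl] at h
    have h' := congrArg (Nat.cast (R := ℚ)) h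
    push_cast at h'
    linarith
  have r1 := ratio_one q K
  have hpos2 : (0 : ℚ) < ((q + K + 2).choose (K + 2) : ℚ) := by exact_mod_cast Nat.choose_pos (by omega)
  have hpos3 : (0 : ℚ) < ((q + K + 3).choose (K + 3) : ℚ) := by exact_mod_cast Nat.choose_pos (by omega)
  rw [div_eq_div_iff hpos2.ne' (by positivity)] at r1
  rw [div_eq_div_iff hpos3.ne' (by positivity)]
  linear_combination (q + K + 3) * r1 - ((K + 2) * q) * c3

/-- `C(q+2, 2) = (q+1)(q+2)/2` and `C(q+1, 1) = q+1`, in ℚ. -/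
lemma choose_two_one (q : ℕ) :
    ((q + 2).choose 2 : ℚ) * 2 = (q + 1) * (q + 2) ∧ ((q + 1).choose 1 : ℚ) = q + 1 := by
  constructor
  · have h := Nat.add_one_mul_choose_eq (q + 1) 1
    rw [Nat.choose_one_right, show q + 1 + 1 = q + 2 by ring, show (1 : ℕ) + 1 = 2 by rfl] at h
    have h' := congrArg (Nat.cast (R := ℚ)) h
    push_cast at h'
    linarith
  · rw [Nat.choose_one_right]; push_cast; ring

/-- **The pure-ℚ core of the slice `#P = 2`** (`q = K + 3 + y`, `K, y ≥ 0`): the polynomial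
`P(K, y)` of 20 positive coefficients. -/
lemma sliceTwo_core (K y : ℚ) (hK : 0 ≤ K) (hy : 0 ≤ y) :
    2 / (K + 3 + y + 1) + 2 / ((K + 3 + y + 1) * (K + 3 + y + 2))
      ≤ 2 * ((K + 2) * (K + 3 + y) / ((K + 3 + y + K + 1) * (K + 3 + y + K + 2)))
        + (K + 1) * (K + 2) / ((K + 3 + y + K + 1) * (K + 3 + y + K + 2))
        + (K + 2) * (K + 3) * (K + 3 + y) / ((K + 3 + y + K + 1) * (K + 3 + y + K + 2) * (K + 3 + y + K + 3)) := by
  rw [← sub_nonneg]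
  have h1 : (0 : ℚ) < K + 3 + y + 1 := by positivity
  have h2 : (0 : ℚ) < K + 3 + y + 2 := by positivity
  have h3 : (0 : ℚ) < K + 3 + y + K + 1 := by positivity
  have h4 : (0 : ℚ) < K + 3 + y + K + 2 := by positivity
  have h5 : (0 : ℚ) < K + 3 + y + K + 3 := by positivity
  have key : 2 * ((K + 2) * (K + 3 + y) / ((K + 3 + y + K + 1) * (K + 3 + y + K + 2)))
        + (K + 1) * (K + 2) / ((K + 3 + y + K + 1) * (K + 3 + y + K + 2))
        + (K + 2) * (K + 3) * (K + 3 + y) / ((K + 3 + y + K + 1) * (K + 3 + y + K + 2) * (K + 3 + y + K + 3))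
        - (2 / (K + 3 + y + 1) + 2 / ((K + 3 + y + 1) * (K + 3 + y + 2)))
      = (600 + 670 * y + 250 * y ^ 2 + 38 * y ^ 3 + 2 * y ^ 4 + 1442 * K + 1339 * K * y + 411 * K * y ^ 2
          + 50 * K * y ^ 3 + 2 * K * y ^ 4 + 1269 * K ^ 2 + 884 * K ^ 2 * y + 186 * K ^ 2 * y ^ 2
          + 12 * K ^ 2 * y ^ 3 + 519 * K ^ 3 + 237 * K ^ 3 * y + 25 * K ^ 3 * y ^ 2 + 99 * K ^ 4
          + 22 * K ^ 4 * y + 7 * K ^ 5)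
        / ((K + 3 + y + 1) * (K + 3 + y + 2) * (K + 3 + y + K + 1) * (K + 3 + y + K + 2) * (K + 3 + y + K + 3)) := by
    field_simp
    ring
  rw [key]
  positivity


/-- **(R̂) on the slice `#P = 2`**, `k = K + 2`, `q ≥ K + 3`: `Φ(q+k, q) ≤ R̂(q, k, 2)`. -/
theorem rhat_two_ge' (q K : ℕ) (hq : K + 3 ≤ q) : phiK (q + (K + 2)) q ≤ rhat q (K + 2) 2 := by
  rw [rhat_two_eq q K hq, phiK_two_eq q K, ← sub_nonneg]
  have hT := sliceTwo_telescope (q + K) (fun j => 1 / ((q + j).choose j : ℚ)) K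
  rw [hT, show q + (K + 2) = q + K + 2 by ring, show q + (K + 3) = q + K + 3 by ring]
  have E1 : 2 * ((q + K).choose (K + 1) : ℚ) * (1 / ((q + K + 2).choose (K + 2) : ℚ))
      = 2 * ((K + 2) * q / ((q + K + 1) * (q + K + 2))) := by
    rw [mul_assoc, mul_one_div, ratio_one]
  have E2 : ((q + K).choose K : ℚ) * (1 / ((q + K + 2).choose (K + 2) : ℚ))
      = (K + 1) * (K + 2) / ((q + K + 1) * (q + K + 2)) := by
    rw [mul_one_div, ratio_two]
  have E3 : ((q + K).choose (K + 1) : ℚ) * (1 / ((q + K + 3).choose (K + 3) : ℚ))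
      = (K + 2) * (K + 3) * q / ((q + K + 1) * (q + K + 2) * (q + K + 3)) := by
    rw [mul_one_div, ratio_three]
  obtain ⟨h22, h11⟩ := choose_two_one q
  have E4 : 2 * (1 / ((q + 1).choose 1 : ℚ)) = 2 / ((q : ℚ) + 1) := by
    rw [h11, mul_one_div]
  have E5 : (1 : ℚ) / ((q + 2).choose 2 : ℚ) = 2 / (((q : ℚ) + 1) * (q + 2)) := by
    have hc : ((q + 2).choose 2 : ℚ) ≠ 0 := by exact_mod_cast (Nat.choose_pos (by omega : 2 ≤ q + 2)).ne'
    rw [div_eq_div_iff hc (by positivity)]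
    linarith
  rw [E1, E2, E3, E4, E5]
  obtain ⟨y, rfl⟩ : ∃ y, q = K + 3 + y := ⟨q - K - 3, by omega⟩
  have core := sliceTwo_core (K : ℚ) (y : ℚ) (by positivity) (by positivity)
  push_cast
  linarith

/-- **(R̂) ON THE SLICE `#P = 2` OF EVERY CELL `(q+k, q)` WITH `q ≥ k + 1`, FOR EVERY `k ≥ 2`**:
`Φ(q+k, q) ≤ R̂(q, k, 2)` — the slice where the untruncated regime `u = q − m ≥ k − 1` is tightest
(relative margin `≈ 1.5/k²` at `q = k + 1`); with `rhat_zero_eq` (`#P = 0`) and `rhatCell_one` (`#P = 1`) the three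
smallest flat parts of every cell family are covered. -/
theorem rhat_two_ge (q k : ℕ) (hk : 2 ≤ k) (hq : k + 1 ≤ q) : phiK (q + k) q ≤ rhat q k 2 := by
  obtain ⟨K, rfl⟩ : ∃ K, k = K + 2 := ⟨k - 2, by omega⟩
  exact rhat_two_ge' q K (by omega)

variable {α : Type} (M : Matroid α) [M.Finite]

/-- **Rule Q pays `Φ(q+k, q)` to every member with `#P = 2`** of every cell `(q+k, q)` with `q ≥ k + 1` at the tight layer
of every finite matroid, every `k ≥ 2`. -/
theorem ruleQRecv_ge_of_flatPart_eq_two {q k : ℕ} (hk : 2 ≤ k) (hq : k + 1 ≤ q) (hE : M.E.ncard = (q + k) + q)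
    {Z : Set α} (hZ : Z ∈ cellMembers M (q + k) q) (hP : (flatPart M Z).ncard = 2) :
    phiK (q + k) q ≤ ruleQRecv M (q + k) q Z := by
  refine le_trans ?_ (rhat_le_ruleQRecv M hE hZ)
  rw [hP]
  exact rhat_two_ge q k hk hq

end PercRepro
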